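import Mathlib.RingTheory.MvPolynomial.Homogeneous
import Mathlib.Algebra.MvPolynomial.PDeriv
import Literature.AlgebraicGeometry.HodgeTheory.FermatEigenspaceHodgeTypes
import Literature.AlgebraicGeometry.HodgeTheory.FermatEigenspaceHodgeDecomposition
import Literature.AlgebraicGeometry.HodgeTheory.FermatEigenspaceRestriction
import Literature.AlgebraicGeometry.HodgeTheory.HodgeFiltration
import Literature.AlgebraicGeometry.HodgeTheory.LefschetzOneOneHolds
import HarnessLib

/-!
# Hodge types of the character eigenlines of the Fermat varieties from Griffiths' residue description of the Hodge filtration (Ran 1980, Prop. 1.7 (ii); Shioda 1979, (1.7))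

Topic `Literature/AlgebraicGeometry/HodgeTheory`. PROOF FILE for the named fact
`Ran1980_fermatEigenspace_hodgeType_pp` (file `FermatEigenspaceHodgeTypes`): on the even-dimensional
Fermat variety `X²ᵖₘ = V₊(Σᵢ xᵢᵐ) ⊂ ℙ²ᵖ⁺¹`, a character eigenline `V(β) ⊂ H²ᵖ(X²ᵖₘ(ℂ); ℂ)`,
`β` zero-free, meets `H^{p,p}` non-trivially only if `|β| = p + 1` (`2 Σ ⟨βᵢ⟩ = m (2p + 2)`) —
the hypothesis `hE4` of the tree's Fermat files.

Shioda, Math. Ann. 245 (1979) §1 (1.7) and Ran, Compositio Math. 42 (1980) §1 Prop. 1.7 (ii)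
("the eigenspace of `χ` lies in `H^{p,q}` with `q` determined by `s(χ)`") read the Hodge types of
the eigenlines off **Griffiths' description of the Hodge filtration of a smooth hypersurface
`Y = V₊(F) ⊂ ℙⁿ⁺¹` by residues of rational forms** (Griffiths 1969 §8; Voisin, *Hodge Theory II*,
§6.1: the residue `Res : Hⁿ⁺¹(ℙⁿ⁺¹ ∖ Y) → Hⁿ(Y)_prim`, Thm. 6.5 — the classes of the forms
`PΩ/Fˡ`, `deg P = l d - n - 2`, span `F^{n+2-l}Hⁿ⁺¹(U)` — whence `α_l : S^{ld-n-2} ↠ F^{n+1-l}Hⁿ(Y)_prim`,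
§6.1.3): the residue is natural for the automorphisms `g_a : [x] ↦ [a • x]` of the pair
`(ℙⁿ⁺¹, Y)` and `g_a^* Ω = (∏ aᵢ) Ω`, so `Res(x^c Ω/Fˡ)` is a `χ_{c+1}`-eigenvector of `μₘⁿ⁺²`, and
`β` occurs among the `x^c` with `Σ (cᵢ + 1) = l m` only if `m |β| ≤ l m`. The tree has Griffiths'
residue only at pole order `1` and as a FORM (`residueForm`, files `HypersurfaceResidueForm*`; no
cohomology of `ℙⁿ⁺¹ ∖ Y`, no Leray residue, no comparison of the pole-order and Hodge filtrations),
so this file takes the two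
printed properties of the residue map it needs — for the Fermat variety `Xⁿₘ`, a pole order `l`
and a Hodge model `A`: a `ℂ`-linear `res : ℂ[x] → Hⁿ(Xⁿₘ(ℂ); ℂ)` with (ii)
`F^{n+1-l}Hⁿ ⊆ res(S^{lm-n-2}) + ι^* Hⁿ(ℙⁿ⁺¹)` and (iii) `g_a^* res(P) = (∏ aᵢ) res(σ_a P)` — as
EXPLICIT HYPOTHESES (no named fact is introduced here, D-0026; the hypersurface-general theorem,
Voisin II (6.2)–(6.3), Thm. 6.5, §6.1.3 with the naturality of the residue, is the named fact
`Griffiths1969_residues_span_hodgeFiltration` of the sibling file `GriffithsResidueComparison`,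
whose clauses (ii)–(iii) at `F = Σ xᵢᵐ` are literally these hypotheses; the Jacobian input of that
fact for `Xⁿₘ` is `exists_eval_pderiv_fermatPolynomial_ne_zero` below), and PROVES:

* `sum_twisted_aeval_diagonalSubst_eq_zero` — the character count: the `χ_β`-isotypic part of a
  form of degree `k` for the twisted action `P ↦ (∏ aᵢ) P(a • x)` of `μₘⁿ⁺²` vanishes when
  `m |β| > k + n + 2`;
* `fermatEigenspace_eq_zero_of_mem_hodgeFiltration_of_residues` — on `Xⁿₘ`,
  `V(β) ∩ F^{n+1-l}Hⁿ = 0` whenever `m |β| > l m` (Ran Prop. 1.7 (ii) / Shioda (1.7) in filtration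
  form), via the isotypic projector `π_β = fermatProjector`, which kills `res(S^{lm-n-2})` by the
  count and the ambient classes `ι^* Hⁿ(ℙⁿ⁺¹) ⊆ V(0)` (`map_diagonalMap_map_hypersurfaceι`);
* `Ran1980_fermatEigenspace_hodgeType_pp_of_residues` — **the named fact
  `Ran1980_fermatEigenspace_hodgeType_pp` from (ii)–(iii) at `l = p + 1`** (plus
  `conj V(β) ⊆ V(-β)` and Hodge symmetry, `fermatEigenspace_eq_zero_of_hodgePQ_swap`, for the
  characters of small length);
* `AokiShioda1983_eigenline_le_neronSeveri_of_residues` — from (ii)–(iii) at `l = 1` for the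
  Fermat surface (the holomorphic `2`-forms are the `Res(PΩ/F)`, `deg P = m - 4`) and Lefschetz
  `(1,1)` (`lefschetzOneOne_rational_holds`), the named fact
  `AokiShioda1983_eigenline_le_neronSeveri` of `FermatSurfaceNeronSeveriEigenlines`.

So the residual obligation of both `Ran1980_fermatEigenspace_hodgeType_pp_holds` and
`AokiShioda1983_eigenline_le_neronSeveri_holds` is Griffiths' theorem
(`Griffiths1969_residues_span_hodgeFiltration`), and nothing Fermat-specific. Not drawn here: the
full "`V(β) ⊂ H^{n+1-|β|,|β|-1}`", which also needs `dim V(β) = 1` (the tree proves `≤ 1`,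
`Ran1980_fermatEigenspace_le_span_holds`). Degrees are encoded additively (`k + (n + 2) = l m`,
no `ℕ`-subtraction).

## References

* [Griffiths1969] P. Griffiths, On the periods of certain rational integrals I, II, Ann. of Math.
  90 (1969) 460–541, §8 (Thm. 8.3) (cite-only).
* [VoisinHodgeII2003] C. Voisin, Hodge Theory and Complex Algebraic Geometry II, CUP 2003, §6.1.1
  (6.2)–(6.3), §6.1.2 Thm. 6.5, §6.1.3 (`α_p`), Thm. 6.10, Cor. 6.12 (text read, pp. 156–161).
* [Ran1980] Z. Ran, Cycles on Fermat hypersurfaces, Compositio Math. 42 (1980) 121–142, §1 Prop. 1.7.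
* [Shioda1979HodgeFermat] T. Shioda, The Hodge conjecture for Fermat varieties, Math. Ann. 245
  (1979) 175–184, §1 (1.7).  * [Shioda1979PJA] T. Shioda, Proc. Japan Acad. 55A (1979), §4.
* [AokiShioda1983] N. Aoki, T. Shioda, Generators of the Néron–Severi group of a Fermat surface,
  Progr. Math. 35 (1983), §2 (2.1).  * [SerreLinearRepresentations1977] J.-P. Serre, §2.6 Thm. 8.
-/

noncomputable section

open CategoryTheory AlgebraicGeometry MvPolynomial Finset

namespace Literature.AlgebraicGeometry.HodgeTheory

open Literature.AlgebraicGeometry.Motives Literature.AlgebraicTopology.SingularHomology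

/-! ### Characters of the monomial forms `x^c Ω / Fˡ` under the diagonal torus -/

section Fermat

variable {n m : ℕ}

/-- `χ_{c+1}(a) = ∏ᵢ aᵢ^{cᵢ + 1}` on `μₘⁿ⁺²` (`aᵢᵐ = 1`), where `(c + 1)ᵢ = cᵢ + 1 (mod m)` is the
character carried by the form `x^c Ω / Fˡ` (the `+1` is the character `∏ aᵢ` of `Ω`).
[cite: Shioda1979HodgeFermat, §1 (1.7)] -/
theorem fermatCharacter_natCast_succ_apply [NeZero m] (c : Fin (n + 2) →₀ ℕ) (a : fermatGroup n m) :
    ((fermatCharacter m (fun i ↦ ((c i + 1 : ℕ) : ZMod m)) a : ℂˣ) : ℂ) =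
      ∏ i, (((a : Fin (n + 2) → ℂˣ) i : ℂˣ) : ℂ) ^ (c i + 1) := by
  rw [fermatCharacter_apply]
  push_cast
  refine Finset.prod_congr rfl fun i _ ↦ ?_
  have hai : (((a : Fin (n + 2) → ℂˣ) i : ℂˣ) : ℂ) ^ m = 1 := by
    rw [← Units.val_pow_eq_pow_val, mem_fermatGroup_iff.mp a.2 i, Units.val_one]
  rw [← Nat.cast_succ, ZMod.val_natCast, ← pow_eq_pow_mod _ hai]

/-- `m |c + 1| ≤ Σᵢ (cᵢ + 1) = deg x^c + (n + 2)`. [cite: Shioda1979HodgeFermat, §1 (1.7)] -/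
theorem normSum_natCast_succ_le [NeZero m] (c : Fin (n + 2) →₀ ℕ) :
    FermatCharacter.normSum (fun i ↦ ((c i + 1 : ℕ) : ZMod m)) ≤ c.degree + (n + 2) := by
  rw [FermatCharacter.normSum]
  calc ∑ i, (((c i + 1 : ℕ) : ZMod m)).val ≤ ∑ i, (c i + 1) :=
        Finset.sum_le_sum fun i _ ↦ by rw [ZMod.val_natCast]; exact Nat.mod_le _ _
    _ = c.degree + (n + 2) := by
        rw [Finset.sum_add_distrib, Finsupp.degree_eq_sum]; simp

/-- **Orthogonality**: `Σ_{a ∈ μₘⁿ⁺²} χ_β(a)⁻¹ ∏ᵢ aᵢ^{cᵢ+1} = 0` unless `c + 1 ≡ β (mod m)`.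
[cite: SerreLinearRepresentations1977, §2.6 Thm. 8] -/
theorem sum_fermatCharacter_inv_mul_prod_pow_succ [NeZero m] (β : Fin (n + 2) → ZMod m)
    (c : Fin (n + 2) →₀ ℕ) (hne : (fun i ↦ ((c i + 1 : ℕ) : ZMod m)) ≠ β) :
    ∑ a : fermatGroup n m, ((fermatCharacter m β a : ℂˣ) : ℂ)⁻¹ *
      ∏ i, (((a : Fin (n + 2) → ℂˣ) i : ℂˣ) : ℂ) ^ (c i + 1) = 0 := by
  have hθ : fermatCharacter m (fun i ↦ ((c i + 1 : ℕ) : ZMod m)) * (fermatCharacter m β)⁻¹ ≠ 1 :=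
    fun h1 ↦ hne (fermatCharacter_injective (mul_inv_eq_one.mp h1))
  rw [← sum_apply_monoidHom_eq_zero hθ]
  refine Finset.sum_congr rfl fun a _ ↦ ?_
  rw [MonoidHom.mul_apply, MonoidHom.inv_apply, Units.val_mul, Units.val_inv_eq_inv_val,
    fermatCharacter_natCast_succ_apply, mul_comm]

/-- **The diagonal substitution on monomials**: `σ_a(r x^c) = (∏ᵢ aᵢ^{cᵢ}) r x^c`. [folklore] -/
theorem aeval_diagonalSubst_monomial (a : Fin (n + 2) → ℂˣ) (c : Fin (n + 2) →₀ ℕ) (r : ℂ) :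
    aeval (diagonalSubst a) (monomial c r) = (∏ i, ((a i : ℂˣ) : ℂ) ^ c i) • monomial c r := by
  rw [aeval_monomial, monomial_eq, Finsupp.prod_fintype _ _ (fun i ↦ by rw [pow_zero]),
    Finsupp.prod_fintype _ _ (fun i ↦ by rw [pow_zero]), smul_eq_C_mul, algebraMap_eq]
  simp only [diagonalSubst_apply, mul_pow, Finset.prod_mul_distrib, ← map_pow, ← map_prod]
  ring

/-- **Character count on a homogeneous numerator.** For `P` homogeneous of degree `k` and `β`
with `m |β| > k + (n + 2)`, the `χ_β`-isotypic part of `P` for the twisted action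
`P ↦ (∏ᵢ aᵢ) σ_a P` of `μₘⁿ⁺²` vanishes, `Σ_a χ_β(a)⁻¹ (∏ᵢ aᵢ) σ_a P = 0`: every monomial `x^c` of
`P` has character `c + 1`, of norm `m |c + 1| ≤ k + n + 2 < m |β|` — the counting step of Shioda
(1.7) / Ran Prop. 1.7 (ii). [cite: Shioda1979HodgeFermat, §1 (1.7)] [cite: Ran1980, §1 Prop. 1.7 (ii)] -/
theorem sum_twisted_aeval_diagonalSubst_eq_zero [NeZero m] (β : Fin (n + 2) → ZMod m) {k : ℕ}
    {P : MvPolynomial (Fin (n + 2)) ℂ} (hP : P.IsHomogeneous k)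
    (hβ : k + (n + 2) < FermatCharacter.normSum β) :
    ∑ a : fermatGroup n m, (((fermatCharacter m β a : ℂˣ) : ℂ)⁻¹ *
        ∏ i, (((a : Fin (n + 2) → ℂˣ) i : ℂˣ) : ℂ)) •
      aeval (diagonalSubst (a : Fin (n + 2) → ℂˣ)) P = 0 := by
  have hexp : ∀ a : fermatGroup n m, aeval (diagonalSubst (a : Fin (n + 2) → ℂˣ)) P =
      ∑ c ∈ P.support, (∏ i, (((a : Fin (n + 2) → ℂˣ) i : ℂˣ) : ℂ) ^ c i) •
        monomial c (coeff c P) := by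
    intro a
    conv_lhs => rw [P.as_sum]
    rw [map_sum]
    exact Finset.sum_congr rfl fun c _ ↦ aeval_diagonalSubst_monomial _ c _
  simp_rw [hexp, Finset.smul_sum, smul_smul]
  rw [Finset.sum_comm]
  refine Finset.sum_eq_zero fun c hc ↦ ?_
  rw [← Finset.sum_smul]
  have hdeg : c.degree = k := by
    by_contra h
    exact (mem_support_iff.mp hc) (hP.coeff_eq_zero h)
  have hne : (fun i ↦ ((c i + 1 : ℕ) : ZMod m)) ≠ β := by
    intro h
    have hle := normSum_natCast_succ_le (m := m) c
    rw [h, hdeg] at hle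
    omega
  have hsum : ∑ a : fermatGroup n m, ((fermatCharacter m β a : ℂˣ) : ℂ)⁻¹ *
      (∏ i, (((a : Fin (n + 2) → ℂˣ) i : ℂˣ) : ℂ)) *
        ∏ i, (((a : Fin (n + 2) → ℂˣ) i : ℂˣ) : ℂ) ^ c i = 0 := by
    rw [← sum_fermatCharacter_inv_mul_prod_pow_succ β c hne]
    refine Finset.sum_congr rfl fun a _ ↦ ?_
    rw [mul_assoc, ← Finset.prod_mul_distrib]
    simp_rw [← pow_succ']
  rw [hsum, zero_smul]

/-! ### Eigenclasses of large length are killed by an equivariant residue presentation -/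

/-- **`π_β` kills the residues of degree-`k` numerators when `m |β| > k + n + 2`.** Let
`res : ℂ[x₀, …, x_{n+1}] → Hⁿ(Xⁿₘ(ℂ); ℂ)` be `ℂ`-linear and equivariant on the forms of degree `k`
for the twisted action, `g_a^* (res P) = (∏ᵢ aᵢ) res (σ_a P)` (`a ∈ μₘⁿ⁺²`) — as Griffiths' residue
map `P ↦ Res(PΩ/Fˡ)` is. Then `π_β (res P) = res (|G|⁻¹ Σ_a χ_β(a)⁻¹ (∏ᵢ aᵢ) σ_a P) = 0` for `P`
homogeneous of degree `k` with `k + n + 2 < m |β|`.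
[cite: Ran1980, §1 Prop. 1.7 (ii)] [cite: Shioda1979HodgeFermat, §1 (1.7)] -/
theorem fermatProjector_apply_eq_zero_of_equivariant [NeZero m] {k : ℕ}
    (res : MvPolynomial (Fin (n + 2)) ℂ →ₗ[ℂ] complexBetti (fermatHypersurface n m) n)
    (hres : ∀ (a : fermatGroup n m) (P : MvPolynomial (Fin (n + 2)) ℂ), P.IsHomogeneous k →
      singularCohomology.map ℂ ℂ
          (diagonalMap (fermatPolynomial ℂ n m) (fermatGroup_le_diagonalStabilizer m a.2)) n (res P) =
        (∏ i, (((a : Fin (n + 2) → ℂˣ) i : ℂˣ) : ℂ)) •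
          res (aeval (diagonalSubst (a : Fin (n + 2) → ℂˣ)) P))
    (β : Fin (n + 2) → ZMod m) (hβ : k + (n + 2) < FermatCharacter.normSum β)
    {P : MvPolynomial (Fin (n + 2)) ℂ} (hP : P.IsHomogeneous k) :
    fermatProjector m β n (res P) = 0 := by
  rw [fermatProjector, eigenProjector_apply]
  simp_rw [hres _ P hP, smul_smul, ← map_smul res, ← map_sum res]
  rw [sum_twisted_aeval_diagonalSubst_eq_zero β hP hβ, map_zero, smul_zero]

/-- **An eigenclass of `χ_β`, `β ≠ 0`, which is the sum of a class killed by `π_β` and an ambient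
class is zero**: `x = π_β x = π_β u + π_β ι^* y = 0 + 0` — `μₘⁿ⁺²` fixes `ι^* y`
(`map_diagonalMap_map_hypersurfaceι`), which therefore lies in `V(0)`, and `π_β V(0) = 0` for
`β ≠ 0`. [cite: Ran1980, §1 (1.1)–(1.5) and Prop. 1.7] [cite: Shioda1979PJA, §4] -/
theorem eq_zero_of_mem_fermatEigenspace_of_fermatProjector_eq_zero [NeZero m]
    {β : Fin (n + 2) → ZMod m} (hβ : β ≠ 0) {k : ℕ}
    {x u : complexBetti (fermatHypersurface n m) k} (hx : x ∈ fermatEigenspace m β k)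
    (hu : fermatProjector m β k u = 0) (y : complexBetti (projectiveSpace (n + 1) ℂ) k)
    (hxy : x = u + complexBetti.map (SmoothHypersurface.hypersurfaceι (fermatPolynomial ℂ n m)) k y) :
    x = 0 := by
  have hy : complexBetti.map (SmoothHypersurface.hypersurfaceι (fermatPolynomial ℂ n m)) k y ∈
      fermatEigenspace m 0 k := by
    rw [mem_fermatEigenspace_iff]
    intro a
    rw [map_diagonalMap_map_hypersurfaceι, show fermatCharacter m (0 : Fin (n + 2) → ZMod m) a = 1 by
      simp [fermatCharacter_apply], Units.val_one, one_smul]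
  have h0 : fermatCharacter m (0 : Fin (n + 2) → ZMod m) ≠ fermatCharacter m β :=
    fun h ↦ hβ (fermatCharacter_injective h).symm
  have hπy : fermatProjector m β k
      (complexBetti.map (SmoothHypersurface.hypersurfaceι (fermatPolynomial ℂ n m)) k y) = 0 :=
    eigenProjector_apply_of_mem_of_ne _ _ hy h0
  rw [← fermatProjector_apply_of_mem hx, hxy, map_add, hu, hπy, add_zero]

/-! ### The Jacobian criterion for the Fermat form -/

/-- `∂F/∂x_j (z) = m z_j^{m-1}` for the Fermat form `F = Σᵢ xᵢᵐ`. [folklore] -/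
theorem eval_pderiv_fermatPolynomial (j : Fin (n + 2)) (z : Fin (n + 2) → ℂ) :
    MvPolynomial.eval z (pderiv j (fermatPolynomial ℂ n m)) = m * z j ^ (m - 1) := by
  classical
  simp only [fermatPolynomial, map_sum, pderiv_pow, pderiv_X, map_mul, map_natCast, map_pow, eval_X]
  rw [Finset.sum_eq_single j]
  · simp
  · intro i _ hij
    simp [hij]
  · simp

/-- **The gradient of the Fermat form vanishes only at the origin** (`m ≥ 1`): at `z ≠ 0` with
`z_j ≠ 0`, `∂F/∂x_j (z) = m z_j^{m-1} ≠ 0`; i.e. `Xⁿₘ` is non-singular (Jacobian criterion).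
[cite: Shioda1979HodgeFermat, §1] -/
theorem exists_eval_pderiv_fermatPolynomial_ne_zero (hm : 1 ≤ m) {z : Fin (n + 2) → ℂ}
    (hz : z ≠ 0) : ∃ j, MvPolynomial.eval z (pderiv j (fermatPolynomial ℂ n m)) ≠ 0 := by
  obtain ⟨j, hj⟩ := Function.ne_iff.mp hz
  refine ⟨j, ?_⟩
  rw [eval_pderiv_fermatPolynomial]
  exact mul_ne_zero (Nat.cast_ne_zero.mpr (by omega)) (pow_ne_zero _ hj)

/-! ### Hodge types of the eigenlines from a residue presentation of the Hodge filtration -/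

/-- **Eigenclasses of length `|β| > l` do not lie in `F^{n+1-l} Hⁿ(Xⁿₘ)`**, granted Griffiths'
residue description of `F^{n+1-l}` at pole order `l` for the Fermat variety, taken here as the two
explicit hypotheses it consists of (Voisin II Thm. 6.5, §6.1.3, and the naturality of the residue;
the named fact `Griffiths1969_residues_span_hodgeFiltration` of `GriffithsResidueComparison`
specialised to `F = Σ xᵢᵐ`): a `ℂ`-linear `res : ℂ[x] → Hⁿ(Xⁿₘ(ℂ); ℂ)` (in print
`P ↦ Res(PΩ/Fˡ)`) with (ii) `F^{n+1-l}Hⁿ ⊆ res(S^{lm-n-2}) + ι^* Hⁿ(ℙⁿ⁺¹)` in the Hodge model `A`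
and (iii) `g_a^* res(P) = (∏ aᵢ) res(σ_a P)` on `S^{lm-n-2}` for `a ∈ μₘⁿ⁺²`. Then for a character
`β` with `m |β| > l m`, every `x ∈ V(β)` with `A^* x ∈ F^{n+1-l}` vanishes: `x = res P + ι^* y`,
and `π_β` kills `ι^* y` (`β ≠ 0`) and `res P` (`fermatProjector_apply_eq_zero_of_equivariant`:
the monomials `x^c` of `P` have `Σ (cᵢ + 1) = l m < m |β|`). This is Ran's Prop. 1.7 (ii) /
Shioda's (1.7) "`V(β) ⊂ H^{p,q}`, `p = n + 1 - |β|`" in the form "`V(β) ∩ F^{n+1-l} = 0` for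
`|β| > l`". [cite: Ran1980, §1 Prop. 1.7 (ii)] [cite: Shioda1979HodgeFermat, §1 (1.7)]
[cite: VoisinHodgeII2003, §6.1.2 Thm. 6.5 and §6.1.3] -/
theorem fermatEigenspace_eq_zero_of_mem_hodgeFiltration_of_residues [NeZero m]
    (A : HodgeModel n (fermatHypersurface n m)) {l : ℕ}
    (res : MvPolynomial (Fin (n + 2)) ℂ →ₗ[ℂ] complexBetti (fermatHypersurface n m) n)
    (hspan : ∀ x : complexBetti (fermatHypersurface n m) n,
      A.pullback n x ∈ A.hodgeFiltration n (n + 1 - l) →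
      x ∈ (⨆ (k : ℕ) (_ : k + (n + 2) = l * m),
            (MvPolynomial.homogeneousSubmodule (Fin (n + 2)) ℂ k).map res) ⊔
          LinearMap.range (complexBetti.map
            (SmoothHypersurface.hypersurfaceι (fermatPolynomial ℂ n m)) n).hom)
    (hequiv : ∀ (a : fermatGroup n m) (k : ℕ) (P : MvPolynomial (Fin (n + 2)) ℂ),
      k + (n + 2) = l * m → P.IsHomogeneous k →
      singularCohomology.map ℂ ℂ
          (diagonalMap (fermatPolynomial ℂ n m) (fermatGroup_le_diagonalStabilizer m a.2)) n (res P) =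
        (∏ i, (((a : Fin (n + 2) → ℂˣ) i : ℂˣ) : ℂ)) • res (aeval (diagonalSubst (a : Fin (n + 2) → ℂˣ)) P))
    {β : Fin (n + 2) → ZMod m} (hβ : l * m < FermatCharacter.normSum β)
    {x : complexBetti (fermatHypersurface n m) n} (hx : x ∈ fermatEigenspace m β n)
    (hxA : A.pullback n x ∈ A.hodgeFiltration n (n + 1 - l)) : x = 0 := by
  have hβ0 : β ≠ 0 := by
    rintro rfl
    simp [FermatCharacter.normSum] at hβ
  obtain ⟨u, hu, v, hv, huv⟩ := Submodule.mem_sup.mp (hspan x hxA)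
  obtain ⟨y, rfl⟩ := LinearMap.mem_range.mp hv
  refine eq_zero_of_mem_fermatEigenspace_of_fermatProjector_eq_zero hβ0 hx ?_ y huv.symm
  -- `π_β` kills the whole residue part `res (S^{lm-n-2})`
  have hker : (⨆ (k : ℕ) (_ : k + (n + 2) = l * m),
      (MvPolynomial.homogeneousSubmodule (Fin (n + 2)) ℂ k).map res) ≤
        LinearMap.ker (fermatProjector m β n) := by
    refine iSup₂_le fun k hk ↦ Submodule.map_le_iff_le_comap.mpr fun P hP ↦ ?_
    rw [Submodule.mem_comap, LinearMap.mem_ker]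
    exact fermatProjector_apply_eq_zero_of_equivariant res (fun a Q hQ ↦ hequiv a k Q hk hQ) β
      (by omega) ((MvPolynomial.mem_homogeneousSubmodule k P).mp hP)
  exact LinearMap.mem_ker.mp (hker hu)

/-- **The `(p,p)` case in every even dimension** (Ran Prop. 1.7 (ii), Shioda (1.7)): the named fact
`Ran1980_fermatEigenspace_hodgeType_pp` from Griffiths' residue description of `Fᵖ H²ᵖ(X²ᵖₘ)` at
pole order `p + 1` (hypothesis `h`: for every `m ≥ 1`, `p > 0` and Hodge model `A`, a `ℂ`-linear
`res` — in print `P ↦ Res(PΩ/F^{p+1})` — with (ii) `Fᵖ H²ᵖ ⊆ res(S^{(p+1)m-2p-2}) + ι^* H²ᵖ(ℙ²ᵖ⁺¹)`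
and (iii) `g_a^* res(P) = (∏ aᵢ) res(σ_a P)`; Voisin II Thm. 6.5 / the named fact
`Griffiths1969_residues_span_hodgeFiltration` at `l = p + 1`). For `β` zero-free and
`0 ≠ x ∈ V(β)` with `A^* x ∈ H^{p,p} ⊆ Fᵖ`: if `m |β| > (p + 1) m` then `x = 0` by the previous
theorem; if `m |β| < (p + 1) m` then `m |-β| = (2p + 2) m - m |β| > (p + 1) m`
(`normSum_add_normSum_neg`) and `conj x ∈ V(-β)` is a non-zero `(p,p)`-class (Hodge symmetry,
`fermatEigenspace_eq_zero_of_hodgePQ_swap`), again impossible; so `2 Σ ⟨βᵢ⟩ = m (2p + 2)`.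
[cite: Ran1980, §1 Prop. 1.7 (ii)–(iii)] [cite: Shioda1979HodgeFermat, §1 (1.7)]
[cite: VoisinHodgeII2003, §6.1.2 Thm. 6.5 and §6.1.3] -/
theorem Ran1980_fermatEigenspace_hodgeType_pp_of_residues
    (h : ∀ (m : ℕ) [NeZero m] (p : ℕ), 0 < p →
      ∀ A : HodgeModel (2 * p) (fermatHypersurface (2 * p) m),
      ∃ res : MvPolynomial (Fin (2 * p + 2)) ℂ →ₗ[ℂ] complexBetti (fermatHypersurface (2 * p) m) (2 * p),
        (∀ x : complexBetti (fermatHypersurface (2 * p) m) (2 * p),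
          A.pullback (2 * p) x ∈ A.hodgeFiltration (2 * p) p →
          x ∈ (⨆ (k : ℕ) (_ : k + (2 * p + 2) = (p + 1) * m),
                (MvPolynomial.homogeneousSubmodule (Fin (2 * p + 2)) ℂ k).map res) ⊔
              LinearMap.range (complexBetti.map
                (SmoothHypersurface.hypersurfaceι (fermatPolynomial ℂ (2 * p) m)) (2 * p)).hom) ∧
        (∀ (a : fermatGroup (2 * p) m) (k : ℕ) (P : MvPolynomial (Fin (2 * p + 2)) ℂ),
          k + (2 * p + 2) = (p + 1) * m → P.IsHomogeneous k →
          singularCohomology.map ℂ ℂ (diagonalMap (fermatPolynomial ℂ (2 * p) m)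
              (fermatGroup_le_diagonalStabilizer m a.2)) (2 * p) (res P) =
            (∏ i, (((a : Fin (2 * p + 2) → ℂˣ) i : ℂˣ) : ℂ)) •
              res (aeval (diagonalSubst (a : Fin (2 * p + 2) → ℂˣ)) P))) :
    Ran1980_fermatEigenspace_hodgeType_pp := by
  intro m _ p hp A β hβ hx
  obtain ⟨x, hx, hx0, hxA⟩ := hx
  obtain ⟨res, hspan, hequiv⟩ := h m p hp A
  have key : ∀ γ : Fin (2 * p + 2) → ZMod m, (p + 1) * m < FermatCharacter.normSum γ →
      ∀ y ∈ fermatEigenspace m γ (2 * p), A.pullback (2 * p) y ∈ A.hodgePQ (2 * p) p p → y = 0 := by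
    intro γ hγ y hy hyA
    refine fermatEigenspace_eq_zero_of_mem_hodgeFiltration_of_residues A (l := p + 1) res
      (fun z hz ↦ hspan z ?_) hequiv hγ hy ?_
    · rwa [show 2 * p + 1 - (p + 1) = p by omega] at hz
    · rw [show 2 * p + 1 - (p + 1) = p by omega]
      exact A.hodgePQ_le_hodgeFiltration (show p + p = 2 * p by omega) le_rfl hyA
  set N := (p + 1) * m with hN
  have hsum : FermatCharacter.normSum β + FermatCharacter.normSum (-β) = 2 * N := by
    rw [FermatCharacter.normSum_add_normSum_neg hβ, hN]; ring
  rcases lt_trichotomy N (FermatCharacter.normSum β) with hlt | heq | hgt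
  · exact absurd (key β hlt x hx hxA) hx0
  · rw [← heq, hN]; ring
  · have hneg : N < FermatCharacter.normSum (-β) := by omega
    exact absurd (fermatEigenspace_eq_zero_of_hodgePQ_swap (by omega) A (key (-β) hneg) hx hxA) hx0

/-- **The `(n,0)` part and the Fermat surface** (same sources): granted Griffiths' residue
description of `Fⁿ Hⁿ(Xⁿₘ) = H^{n,0}` at pole order `1` for the Fermat SURFACE (`n = 2`; in
print `H⁰(X²ₘ, Ω²) = {Res(PΩ/F) : deg P = m - 4}`, with the naturality of the residue), the Hodge
eigenlines `V(β)`, `β ∈ 𝔅²ₘ` (`m |β| = 2m > m`), contain no non-zero `(2,0)`-class, so — with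
Lefschetz `(1,1)` (`lefschetzOneOne_rational_holds`) — the named fact
`AokiShioda1983_eigenline_le_neronSeveri` (Aoki–Shioda (2.1): `V(β) ⊆ NS(X²ₘ) ⊗ ℂ` for
`β ∈ 𝔅²ₘ`) follows (`AokiShioda1983_eigenline_le_neronSeveri_of_lefschetzOneOne_of_twoZero`).
[cite: AokiShioda1983, §2 (2.1)–(2.2), p. 3] [cite: Shioda1979HodgeFermat, §1 (1.7) and Thm. I]
[cite: VoisinHodgeII2003, §6.1.2 Thm. 6.5 and §6.1.3] -/
theorem AokiShioda1983_eigenline_le_neronSeveri_of_residues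
    (h : ∀ (m : ℕ) [NeZero m] (A : HodgeModel 2 (fermatHypersurface 2 m)),
      ∃ res : MvPolynomial (Fin 4) ℂ →ₗ[ℂ] complexBetti (fermatHypersurface 2 m) 2,
        (∀ x : complexBetti (fermatHypersurface 2 m) 2,
          A.pullback 2 x ∈ A.hodgeFiltration 2 2 →
          x ∈ (⨆ (k : ℕ) (_ : k + 4 = 1 * m),
                (MvPolynomial.homogeneousSubmodule (Fin 4) ℂ k).map res) ⊔
              LinearMap.range (complexBetti.map
                (SmoothHypersurface.hypersurfaceι (fermatPolynomial ℂ 2 m)) 2).hom) ∧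
        (∀ (a : fermatGroup 2 m) (k : ℕ) (P : MvPolynomial (Fin 4) ℂ),
          k + 4 = 1 * m → P.IsHomogeneous k →
          singularCohomology.map ℂ ℂ (diagonalMap (fermatPolynomial ℂ 2 m)
              (fermatGroup_le_diagonalStabilizer m a.2)) 2 (res P) =
            (∏ i, (((a : Fin 4 → ℂˣ) i : ℂˣ) : ℂ)) • res (aeval (diagonalSubst (a : Fin 4 → ℂˣ)) P))) :
    AokiShioda1983_eigenline_le_neronSeveri := by
  refine AokiShioda1983_eigenline_le_neronSeveri_of_lefschetzOneOne_of_twoZero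
    lefschetzOneOne_rational_holds fun m _ β hβ x hx hxA ↦ ?_
  obtain ⟨A, hA⟩ := hxA
  obtain ⟨res, hspan, hequiv⟩ := h m A
  have h2 : 2 * FermatCharacter.normSum β = m * 4 := hβ.two_mul_normSum_eq
  have hm : 1 ≤ m := NeZero.one_le
  refine fermatEigenspace_eq_zero_of_mem_hodgeFiltration_of_residues A (l := 1) res
    (fun z hz ↦ hspan z (by simpa using hz)) hequiv (by omega) hx ?_
  exact A.hodgePQ_le_hodgeFiltration (show 2 + 0 = 2 by rfl) le_rfl hA

end Fermat

end Literature.AlgebraicGeometry.HodgeTheory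

end
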